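import Literature.NumberTheory.GaloisRepresentations.SemiLocalUnitGroupUnramified
import Literature.Algebra.Homology.TateCohomologyShapiro
import Literature.Algebra.Homology.TateCohomologyShapiroNegOne
import HarnessLib

/-!
# Shapiro in every Tate degree for the semi-local modules, and `Ĥⁿ(Gal(E/F), ∏_{w ∣ v} 𝒪_wˣ) = 0` for all
# `n ∈ ℤ` at an unramified place (Harari Prop. 13.1 (b): "`Ĥ^i(G, I_K(v)) = Ĥ^i(G_v, K_v^*)`",
# "`Ĥ^i(G, U_K(v)) = Ĥ^i(G_v, U_{K,v}) = 0`"; Brown VI (5.2))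

Topic `NumberTheory/GaloisRepresentations`; namespaces `Literature.NumberTheory.GaloisRepresentations.RepSES`
(§0, generic) and `….SemiLocal`.  Sequel of `SemiLocalUnitGroupUnramified.lean` (positive degrees and
degree `0`) completing the TATE-cohomology form that Harari's Prop. 13.1 (b) states ("for any
`i ∈ ℤ`"): the engine proves Shapiro for Mathlib's `tateCohomology` degree by degree
(`TateCohomologyShapiro`: `0`, `≥ 1`, `≤ -2`; `TateCohomologyShapiroNegOne`: `-1`); §0 assembles the
all-`n` transfer of vanishing, §1 applies it to `∏_{w∣v} E_wˣ ≅ Coind_{G_w}^G E_wˣ` and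
`∏_{w∣v} 𝒪_wˣ ≅ Coind_{G_w}^G 𝒪_wˣ` (`unitsRepIsoCoind`, `unitGroupRepIsoCoind`), and §2 combines the
unit-group transfer with the cyclic-group periodicity (`isZero_tateCohomology_of_isCyclic`,
`isCyclic_stabilizer`), `Ĥ⁰(G_w, 𝒪_wˣ) = 0` (`isZero_tateCohomology_zero_localIntUnitsRep`) and
`H¹(G_w, 𝒪_wˣ) = 0` (`isZero_H1_localIntUnitsRep`) to get **`Ĥⁿ(Gal(E/F), ∏_{w∣v} 𝒪_wˣ) = 0` for every
`n ∈ ℤ`** at a place unramified in `E`.  Theorems only; NO definition, no named fact, no `sorry`, no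
instance; number fields in `Type`.

## What is formalised

* §0 `RepSES.isZero_tateCohomology_coind_iff S B n : Ĥⁿ(G, Coind_S^G B) = 0 ↔ Ĥⁿ(S, B) = 0`, every
  `n ∈ ℤ` (case split over the engine's four degree ranges).
* §1 `isZero_tateCohomology_unitsRep_iff w n : Ĥⁿ(Gal(E/F), ∏_{w∣v} E_wˣ) = 0 ↔ Ĥⁿ(G_w, E_wˣ) = 0` and
  `isZero_tateCohomology_unitGroupRep_iff w n : Ĥⁿ(Gal(E/F), ∏_{w∣v} 𝒪_wˣ) = 0 ↔ Ĥⁿ(G_w, 𝒪_wˣ) = 0`,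
  every `n ∈ ℤ`.
* §2 at a place unramified in `E`: **`isZero_tateCohomology_localIntUnitsRep`** (`Ĥⁿ(G_w, 𝒪_wˣ) = 0`,
  all `n`) and **`isZero_tateCohomology_unitGroupRep`** (`Ĥⁿ(Gal(E/F), ∏_{w∣v} 𝒪_wˣ) = 0`, all `n`).

## References
* D. Harari, *Galois Cohomology and Class Field Theory*, Springer (2020), §13.1, proof of Prop. 13.1 (b).
  [Harari2020]
* K. S. Brown, *Cohomology of Groups*, GTM 87 (1982), VI (5.2). [Brown1982CohomologyGroups]
* J. W. S. Cassels, A. Fröhlich (eds.), *Algebraic Number Theory* (1967), Ch. VII (Tate) §7.2–7.3.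
  [CasselsFrohlichANT1967]
-/

noncomputable section

open NumberField IsDedekindDomain CategoryTheory CategoryTheory.Limits groupCohomology
open Literature.NumberTheory.Automorphic
open scoped Classical

namespace Literature.NumberTheory.GaloisRepresentations

/-! ## §0. Shapiro for Tate cohomology, all degrees, as a transfer of vanishing -/

namespace RepSES

open Literature.Algebra.Homology

universe u

variable {k G : Type u} [CommRing k] [Group G] [Fintype G] (S : Subgroup G) (B : Rep.{u} k S)

/-- **`Ĥⁿ(G, Coind_S^G B) = 0 ↔ Ĥⁿ(S, B) = 0` for every `n ∈ ℤ`** (Brown VI (5.2); the engine's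
`isZero_tateCohomology_coind_{zero,ofNat,negSucc}_iff` and `CoindShapiro.…_negOne_iff` by cases on `n`).
[cite: Brown1982CohomologyGroups, VI (5.2)] -/
theorem isZero_tateCohomology_coind_iff (n : ℤ) :
    IsZero (tateCohomology (Rep.coind S.subtype B) n) ↔ IsZero (tateCohomology B n) := by
  match n with
  | Int.ofNat 0 => exact isZero_tateCohomology_coind_zero_iff S B
  | Int.ofNat (m + 1) => exact isZero_tateCohomology_coind_ofNat_iff S B m
  | Int.negSucc 0 => exact CoindShapiro.isZero_tateCohomology_coind_negOne_iff S B
  | Int.negSucc (m + 1) => exact isZero_tateCohomology_coind_negSucc_iff S B m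

end RepSES

namespace SemiLocal

open Literature.Algebra.Homology Literature.NumberTheory.NumberFields

variable {F : Type} [Field F] [NumberField F] {E : Type} [Field E] [NumberField E] [Algebra F E]
variable {v : HeightOneSpectrum (𝓞 F)}

/-! ## §1. Tate Shapiro for `∏_{w ∣ v} E_wˣ` and `∏_{w ∣ v} 𝒪_wˣ` -/

/-- **`Ĥⁿ(Gal(E/F), ∏_{w∣v} E_wˣ) = 0 ↔ Ĥⁿ(G_w, E_wˣ) = 0`**, every `n ∈ ℤ` (Harari:
"`Ĥ^i(G, I_K(v)) = Ĥ^i(G_v, K_v^*)`"; along `unitsRepIsoCoind` and §0). [cite: Harari2020, §13.1 (proof of Prop. 13.1 (b))] -/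
theorem isZero_tateCohomology_unitsRep_iff [IsGalois F E] (w : Place F E v) (n : ℤ) :
    IsZero (tateCohomology (unitsRep F E v) n) ↔ IsZero (tateCohomology (localUnitsRep w) n) :=
  (Iff.intro (fun h => h.of_iso ((tateCohomologyFunctor n).mapIso (unitsRepIsoCoind w)).symm)
    (fun h => h.of_iso ((tateCohomologyFunctor n).mapIso (unitsRepIsoCoind w)))).trans
    (RepSES.isZero_tateCohomology_coind_iff _ _ n)

/-- **`Ĥⁿ(Gal(E/F), ∏_{w∣v} 𝒪_wˣ) = 0 ↔ Ĥⁿ(G_w, 𝒪_wˣ) = 0`**, every `n ∈ ℤ` (Harari: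
"`Ĥ^i(G, U_K(v)) = Ĥ^i(G_v, U_{K,v})`"; along `unitGroupRepIsoCoind` and §0).
[cite: Harari2020, §13.1 (proof of Prop. 13.1 (b))] -/
theorem isZero_tateCohomology_unitGroupRep_iff [IsGalois F E] (w : Place F E v) (n : ℤ) :
    IsZero (tateCohomology (unitGroupRep F E v) n) ↔ IsZero (tateCohomology (localIntUnitsRep w) n) :=
  (Iff.intro (fun h => h.of_iso ((tateCohomologyFunctor n).mapIso (unitGroupRepIsoCoind w)).symm)
    (fun h => h.of_iso ((tateCohomologyFunctor n).mapIso (unitGroupRepIsoCoind w)))).trans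
    (RepSES.isZero_tateCohomology_coind_iff _ _ n)

/-! ## §2. All Tate degrees of the unit modules vanish at an unramified place -/

/-- **`Ĥⁿ(G_w, 𝒪_wˣ) = 0` for every `n ∈ ℤ`** at a place unramified in `E` (`G_w` cyclic,
`isCyclic_stabilizer`; period two from `Ĥ⁰(G_w, 𝒪_wˣ) = 0` and `H¹(G_w, 𝒪_wˣ) = 0`).
[cite: Harari2020, Prop. 8.3 and §13.1 (proof of Prop. 13.1 (b))] -/
theorem isZero_tateCohomology_localIntUnitsRep [IsGalois F E] (w : Place F E v)
    (hunr : Algebra.IsUnramifiedIn (𝓞 E) v.asIdeal) (n : ℤ) :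
    IsZero (tateCohomology (localIntUnitsRep w) n) :=
  haveI := isCyclic_stabilizer w hunr
  isZero_tateCohomology_of_isCyclic _ (isZero_tateCohomology_zero_localIntUnitsRep w hunr)
    ((CohomologicalTriviality.isZero_tateCohomology_iff_groupCohomology _ 1).mpr
      (isZero_H1_localIntUnitsRep w (ramificationIdx_place_eq_one w hunr))) n

/-- **`Ĥⁿ(Gal(E/F), ∏_{w ∣ v} 𝒪_wˣ) = 0` for every `n ∈ ℤ` at a place `v` unramified in `E`** — Harari's
"`Ĥ^i(G, U_K(v)) = Ĥ^i(G_v, U_{K,v}) = 0`" in every Tate degree (Shapiro §1 + the local vanishing).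
[cite: Harari2020, §13.1 (proof of Prop. 13.1 (b))][cite: CasselsFrohlichANT1967, Ch. VII §7.3] -/
theorem isZero_tateCohomology_unitGroupRep [IsGalois F E] (v : HeightOneSpectrum (𝓞 F))
    (hunr : Algebra.IsUnramifiedIn (𝓞 E) v.asIdeal) (n : ℤ) :
    IsZero (tateCohomology (unitGroupRep F E v) n) := by
  obtain ⟨w⟩ := (inferInstance : Nonempty (Place F E v))
  exact (isZero_tateCohomology_unitGroupRep_iff w n).mpr (isZero_tateCohomology_localIntUnitsRep w hunr n)

end SemiLocal

end Literature.NumberTheory.GaloisRepresentations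

end
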